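import Summits.Parity.BatemanHorn.Theorems.LSDRealSegment.Negative.LinearRung

/-!
# `LSDRealSegment` — the first non-monic rung `f = 2X + 1`: the crux HOLDS there with `Λ = (2 - z) F(1,z)`, pin `Λ 0 = 2`

Support for crux `stmt-Parity-9770` (`…SelbergDelangeRigidity.LSDRealSegment`), standing disprover cycle 2; sequel of
`Negative/LinearRung.lean`. `sum_cardFactors_Icc_eq_odd_add`: the exact dyadic identity `A_y(X) = O_y(X) + y A_y(⌊X/2⌋)`,
so `O_y(2x+1) = A_y(2x+1) - y A_y(x)`. `tendsto_normSum_twoX_add_one` / `lsdRealSegment_conclusion_twoX_add_one`: for the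
Bateman–Horn system `(2X+1)` the normalised sum tends to `(2 - y) F(1,y)/Γ(y)`, so the conclusion HOLDS with
`Λ(z) = (2 - z) F(1,z)` (holomorphic on `|z| < 2`) and `Λ 0 = 2 = C(2X+1)` — the pin is checked at a value `≠ 1` (a slip
`q/φ(q)` or a `D`-normalisation error at `z = 0` would have survived `f = X`). The factor `2 - z` cancels the pole of
`F(1,·)` at `2`: the wall at `2` (`WallAtTwo*`, `SharpRadius`) is the `p = 2` factor of the system `f = X`, not universal.
-/

open Filter Polynomial Finset
open scoped Topology

namespace Summit.Parity.BatemanHorn.Theorems.LSDRealSegment.Negative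

open Literature.NumberTheory.Sieve
open Summit.Parity.BatemanHorn.Theorems.SystemLSDRealSegment.Negative
open ArithmeticFunction (cardFactors)
open Literature.NumberTheory.LFunctions
open Literature.NumberTheory.LFunctions.SelbergDelangeOmega

noncomputable section

/-! ## The dyadic identity -/

/-- `Ω(2m) = 1 + Ω(m)` for `m ≠ 0`. [folklore] -/
theorem cardFactors_two_mul {m : ℕ} (hm : m ≠ 0) : cardFactors (2 * m) = 1 + cardFactors m := by
  rw [ArithmeticFunction.cardFactors_mul two_ne_zero hm, ArithmeticFunction.cardFactors_apply_prime Nat.prime_two]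

/-- The even numbers of `[1, X]` are `{2m : m ∈ [1, X/2]}`. [folklore] -/
theorem filter_even_Icc_eq_image (X : ℕ) :
    (Icc 1 X).filter (fun m => ¬Odd m) = (Icc 1 (X / 2)).image fun m => 2 * m := by
  ext n
  simp only [Finset.mem_filter, Finset.mem_Icc, Finset.mem_image, Nat.not_odd_iff_even]
  constructor
  · rintro ⟨⟨h1, hX⟩, ⟨c, rfl⟩⟩
    exact ⟨c, ⟨by omega, by omega⟩, by omega⟩
  · rintro ⟨c, ⟨hc1, hcX⟩, rfl⟩
    exact ⟨⟨by omega, by omega⟩, ⟨c, by ring⟩⟩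

/-- **`A_y(X) = O_y(X) + y · A_y(⌊X/2⌋)`** (split `[1, X]` into odd and even `m = 2m'`, `Ω(2m') = 1 + Ω(m')`). [folklore] -/
theorem sum_cardFactors_Icc_eq_odd_add (w : ℂ) (X : ℕ) :
    ∑ m ∈ Icc 1 X, w ^ cardFactors m =
      ∑ m ∈ (Icc 1 X).filter Odd, w ^ cardFactors m + w * ∑ m ∈ Icc 1 (X / 2), w ^ cardFactors m := by
  rw [← Finset.sum_filter_add_sum_filter_not (Icc 1 X) Odd, filter_even_Icc_eq_image,
    Finset.sum_image fun a _ b _ (h : 2 * a = 2 * b) => by omega, Finset.mul_sum]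
  congr 1
  refine Finset.sum_congr rfl fun m hm => ?_
  rw [Finset.mem_Icc] at hm
  rw [cardFactors_two_mul (by omega), pow_add, pow_one]

/-- The odd numbers of `[1, 2x+1]` are `{2n+1 : n ∈ range (x+1)}`. [folklore] -/
theorem filter_odd_Icc_eq_image_range (x : ℕ) :
    (Icc 1 (2 * x + 1)).filter Odd = (Finset.range (x + 1)).image fun n => 2 * n + 1 := by
  ext m
  simp only [Finset.mem_filter, Finset.mem_Icc, Finset.mem_image, Finset.mem_range]
  constructor
  · rintro ⟨⟨h1, hX⟩, ⟨c, rfl⟩⟩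
    exact ⟨c, by omega, rfl⟩
  · rintro ⟨c, hc, rfl⟩
    exact ⟨⟨by omega, by omega⟩, ⟨c, rfl⟩⟩

/-- The crux's sum for `f = 2X + 1` is the odd sum `O(2x+1) = A(2x+1) - y A(x)`. [folklore] -/
theorem sum_twoX_add_one_eq (x : ℕ) (w : ℂ) :
    ∑ n ∈ Finset.range (x + 1), w ^ (∑ i, cardFactors ((((![C 2 * X + C 1] : Fin 1 → ℤ[X]) i).eval (n : ℤ)).toNat)) =
      ∑ m ∈ Icc 1 (2 * x + 1), w ^ cardFactors m - w * ∑ m ∈ Icc 1 x, w ^ cardFactors m := by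
  have h : ∀ n : ℕ, (∑ i, cardFactors ((((![C 2 * X + C 1] : Fin 1 → ℤ[X]) i).eval (n : ℤ)).toNat)) =
      cardFactors (2 * n + 1) := fun n => by
    simp only [Fin.sum_univ_one, Matrix.cons_val_fin_one, eval_add, eval_mul, eval_C, eval_X]
    have : (2 * (n : ℤ) + 1) = ((2 * n + 1 : ℕ) : ℤ) := by push_cast; ring
    rw [this, Int.toNat_natCast]
  simp_rw [h]
  rw [sum_cardFactors_Icc_eq_odd_add w (2 * x + 1), filter_odd_Icc_eq_image_range,
    Finset.sum_image fun a _ b _ (h : 2 * a + 1 = 2 * b + 1) => by omega,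
    show (2 * x + 1) / 2 = x by omega]
  ring

/-! ## `(2X + 1)` is a Bateman–Horn system with `ω(2) = 0`, `ω(p) = 1` (`p` odd), `C(2X+1) = 2` -/

/-- `p ∣ 2n+1` with `n < p`: only `2n + 1 = p`. So `ω_{2X+1}(p) = 1` for odd primes and `= 0` for `p = 2`. [folklore] -/
theorem polyRootCountMod_twoX_add_one {p : ℕ} (hp : p.Prime) :
    polyRootCountMod (![C 2 * X + C 1] : Fin 1 → ℤ[X]) p = if p = 2 then 0 else 1 := by
  unfold polyRootCountMod
  have hdvd : ∀ n : ℕ, ((p : ℤ) ∣ ∏ i, ((![C 2 * X + C 1] : Fin 1 → ℤ[X]) i).eval (n : ℤ)) ↔ p ∣ 2 * n + 1 := by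
    intro n
    simp only [Fin.prod_univ_one, Matrix.cons_val_fin_one, eval_add, eval_mul, eval_C, eval_X]
    have : (2 * (n : ℤ) + 1) = ((2 * n + 1 : ℕ) : ℤ) := by push_cast; ring
    rw [this, Int.natCast_dvd_natCast]
  simp_rw [hdvd]
  split_ifs with h2
  · subst h2
    rw [Finset.card_eq_zero, Finset.filter_eq_empty_iff]
    intro n _ h
    omega
  · have hodd : Odd p := hp.odd_of_ne_two h2
    obtain ⟨c, hc⟩ := hodd
    rw [Finset.card_eq_one]
    refine ⟨c, ?_⟩
    ext n
    simp only [Finset.mem_filter, Finset.mem_range, Finset.mem_singleton]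
    constructor
    · rintro ⟨hn, t, ht⟩
      have ht1 : t = 1 := by
        rcases Nat.lt_or_ge t 2 with h | h
        · interval_cases t
          · omega
          · rfl
        · nlinarith [hp.two_le]
      subst ht1
      omega
    · rintro rfl
      exact ⟨by omega, ⟨1, by omega⟩⟩

/-- `(2X + 1)` is a Bateman–Horn system. [folklore] -/
theorem isBatemanHornSystem_twoX_add_one : IsBatemanHornSystem (![C 2 * X + C 1] : Fin 1 → ℤ[X]) where
  irreducible i := by
    have hprim : (C 2 * X + C 1 : ℤ[X]).IsPrimitive := by
      rw [Polynomial.isPrimitive_iff_isUnit_of_C_dvd]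
      intro r hr
      have h0 := (Polynomial.C_dvd_iff_dvd_coeff r _).1 hr 0
      simp at h0
      exact isUnit_of_dvd_one h0
    have hirr : Irreducible ((C 2 * X + C 1 : ℤ[X]).map (algebraMap ℤ ℚ)) := by
      simp only [Polynomial.map_add, Polynomial.map_mul, Polynomial.map_C, Polynomial.map_X]
      exact Polynomial.irreducible_of_degree_eq_one (Polynomial.degree_linear (by norm_num))
    simpa using (hprim.irreducible_iff_irreducible_map_fraction_map (K := ℚ)).2 hirr
  leadingCoeff_pos i := by
    simp only [Matrix.cons_val_fin_one]
    rw [Polynomial.leadingCoeff_linear (by norm_num)]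
    norm_num
  pairwise_not_associated := Subsingleton.pairwise
  hasNoFixedPrimeDivisor p hp := by
    rw [polyRootCountMod_twoX_add_one hp]
    split_ifs with h
    · exact hp.pos
    · exact hp.one_lt

/-- `C(2X + 1) = 2` (`= q/φ(q)` with `q = 2`): the partial products equal `2` from `x = 2` on. [folklore] -/
theorem batemanHornConst_twoX_add_one : batemanHornConst (![C 2 * X + C 1] : Fin 1 → ℤ[X]) = 2 := by
  have hpart : ∀ x : ℕ, 2 ≤ x → batemanHornPartial (![C 2 * X + C 1] : Fin 1 → ℤ[X]) x = 2 := by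
    intro x hx
    unfold batemanHornPartial
    have h2 : 2 ∈ Nat.primesLE x := Nat.mem_primesLE.2 ⟨hx, Nat.prime_two⟩
    rw [← Finset.mul_prod_erase _ _ h2, polyRootCountMod_twoX_add_one Nat.prime_two, if_pos rfl]
    have hrest : ∏ p ∈ (Nat.primesLE x).erase 2,
        (1 - 1 / (p : ℝ))⁻¹ ^ Fintype.card (Fin 1) * (1 - (polyRootCountMod (![C 2 * X + C 1] : Fin 1 → ℤ[X]) p : ℝ) / p)
        = 1 := by
      refine Finset.prod_eq_one fun p hp => ?_
      have hp2 : p ≠ 2 := Finset.ne_of_mem_erase hp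
      have hp' : p.Prime := Nat.prime_of_mem_primesLE (Finset.mem_of_mem_erase hp)
      have hp0 : (0 : ℝ) < p := by exact_mod_cast hp'.pos
      have hlt : 1 / (p : ℝ) < 1 := by rw [div_lt_one hp0]; exact_mod_cast hp'.one_lt
      rw [polyRootCountMod_twoX_add_one hp', if_neg hp2, Fintype.card_fin, pow_one, Nat.cast_one]
      exact inv_mul_cancel₀ (ne_of_gt (by linarith))
    rw [hrest]
    norm_num
  refine HasBatemanHornConst.batemanHornConst_eq ?_
  refine (tendsto_const_nhds (x := (2 : ℝ))).congr' ?_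
  filter_upwards [eventually_ge_atTop 2] with x hx
  exact (hpart x hx).symm

/-! ## The segment law at `f = 2X + 1`: `H_x(y) → (2 - y) F(1,y)/Γ(y)` -/

/-- `log log (2x+1) - log log x → 0`. [folklore] -/
theorem tendsto_loglog_twoX_add_one_sub :
    Tendsto (fun x : ℕ => Real.log (Real.log (2 * x + 1)) - Real.log (Real.log x)) atTop (𝓝 0) := by
  have hlog : Tendsto (fun x : ℕ => Real.log x) atTop atTop := Real.tendsto_log_atTop.comp tendsto_natCast_atTop_atTop
  have hratio : Tendsto (fun x : ℕ => Real.log (2 * x + 1) / Real.log x) atTop (𝓝 1) := by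
    have hnum : Tendsto (fun x : ℕ => Real.log (2 + (x : ℝ)⁻¹)) atTop (𝓝 (Real.log 2)) := by
      have : Tendsto (fun x : ℕ => 2 + (x : ℝ)⁻¹) atTop (𝓝 2) := by
        simpa using tendsto_const_nhds.add (tendsto_inv_atTop_nhds_zero_nat (𝕜 := ℝ))
      exact (Real.continuousAt_log (by norm_num)).tendsto.comp this
    have hquot : Tendsto (fun x : ℕ => Real.log (2 + (x : ℝ)⁻¹) / Real.log x) atTop (𝓝 0) :=
      hnum.div_atTop hlog
    have h1 : Tendsto (fun x : ℕ => 1 + Real.log (2 + (x : ℝ)⁻¹) / Real.log x) atTop (𝓝 1) := by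
      simpa using tendsto_const_nhds.add hquot
    refine h1.congr' ?_
    filter_upwards [eventually_ge_atTop 2] with x hx
    have hx0 : (0 : ℝ) < x := by exact_mod_cast (show 0 < x by omega)
    have hlx : Real.log x ≠ 0 := by
      have : 1 < (x : ℝ) := by exact_mod_cast (show 1 < x by omega)
      exact (Real.log_pos this).ne'
    have hsplit : Real.log (2 * x + 1) = Real.log x + Real.log (2 + (x : ℝ)⁻¹) := by
      rw [← Real.log_mul hx0.ne' (by positivity)]
      congr 1
      field_simp
    rw [hsplit]
    field_simp
  have h := (Real.continuousAt_log one_ne_zero).tendsto.comp hratio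
  rw [Real.log_one] at h
  refine h.congr' ?_
  filter_upwards [eventually_ge_atTop 2] with x hx
  have hx1 : (1 : ℝ) < x := by exact_mod_cast (show 1 < x by omega)
  have hlx : 0 < Real.log x := Real.log_pos hx1
  have hl2 : 0 < Real.log (2 * x + 1) := Real.log_pos (by linarith)
  simp only [Function.comp_apply]
  rw [Real.log_div hl2.ne' hlx.ne']

/-- **SEGMENT LAW AT `f = 2X + 1`** (for every real `1 ≤ y < 2`):
`x⁻¹ (log x)^{1-y} Σ_{n ≤ x} y^{Ω(2n+1)} → (2 - y) F(1,y)/Γ(y)` (dyadic identity + Selberg's theorem at `2x+1` and at `x`).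
[cite: MontgomeryVaughan2007, §7.4 Theorem 7.18 and (7.60)] -/
theorem tendsto_normSum_twoX_add_one {y : ℝ} (hy1 : 1 ≤ y) (hy2 : y < 2) :
    Tendsto (fun x : ℕ => (x : ℂ)⁻¹ * Complex.exp (((1 : ℕ) : ℂ) * (1 - (y : ℂ)) * (Real.log (Real.log x) : ℂ)) *
      ∑ n ∈ Finset.range (x + 1), (y : ℂ) ^ (∑ i, cardFactors ((((![C 2 * X + C 1] : Fin 1 → ℤ[X]) i).eval (n : ℤ)).toNat)))
      atTop (𝓝 ((2 - (y : ℂ)) * selbergDelangeOmegaF y * (Complex.Gamma y)⁻¹)) := by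
  obtain ⟨K, hK⟩ := MontgomeryVaughan2007_thm_7_18_Omega_holds y hy2
  set w : ℂ := (y : ℂ) with hw
  set G : ℂ := selbergDelangeOmegaF w * (Complex.Gamma w)⁻¹ with hG
  have hwn : ‖w‖ ≤ y := by rw [hw, Complex.norm_real, Real.norm_eq_abs, abs_of_nonneg (by linarith)]
  set A : ℕ → ℂ := fun X => ∑ m ∈ Icc 1 X, w ^ cardFactors m with hA
  set e : ℕ → ℂ := fun x => Complex.exp (((1 : ℕ) : ℂ) * (1 - w) * (Real.log (Real.log x) : ℂ)) with he
  set ρ : ℕ → ℂ := fun x => e x * (((Real.log (2 * x + 1) : ℝ) : ℂ) ^ (w - 1)) with hρ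
  set Err : ℕ → ℂ := fun x => (x : ℂ)⁻¹ * e x *
      ((A (2 * x + 1) - G * ((2 * x + 1 : ℕ) : ℂ) * ((Real.log (2 * x + 1) : ℝ) : ℂ) ^ (w - 1)) -
        w * (A x - G * (x : ℂ) * ((Real.log x : ℝ) : ℂ) ^ (w - 1))) with hErr
  have hdecomp : ∀ x : ℕ, 3 ≤ x →
      (x : ℂ)⁻¹ * e x * ∑ n ∈ Finset.range (x + 1), w ^ (∑ i, cardFactors ((((![C 2 * X + C 1] : Fin 1
          → ℤ[X]) i).eval (n : ℤ)).toNat)) =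
        (2 - w) * G + (Err x + G * ((2 + (x : ℂ)⁻¹) * ρ x - 2)) := by
    intro x hx
    have hx0 : (0 : ℝ) < x := by exact_mod_cast (show 0 < x by omega)
    have hL : 0 < Real.log x := Real.log_pos (by exact_mod_cast (show 1 < x by omega))
    have he1 : e x * (((Real.log x : ℝ) : ℂ) ^ (w - 1)) = 1 := exp_mul_cpow_eq_one hL w
    have hxne : (x : ℂ) ≠ 0 := by exact_mod_cast (show (x : ℕ) ≠ 0 by omega)
    have hxinv : (x : ℂ)⁻¹ * (x : ℂ) = 1 := inv_mul_cancel₀ hxne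
    have hcast : ((2 * x + 1 : ℕ) : ℂ) = 2 * (x : ℂ) + 1 := by push_cast; ring
    rw [sum_twoX_add_one_eq]
    simp only [hErr, hρ, hA, hcast]
    linear_combination (2 * G * e x * (((Real.log (2 * (x : ℝ) + 1) : ℝ) : ℂ) ^ (w - 1)) - w * G) * hxinv
      + (-(w * G) * ((x : ℂ)⁻¹ * (x : ℂ))) * he1
  have hErr0 : Tendsto Err atTop (𝓝 0) := by
    have hbound : ∀ x : ℕ, 3 ≤ x → ‖Err x‖ ≤ 5 * max K 0 * (Real.log x) ^ (-(2 - y)) := by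
      intro x hx
      have hx0 : (0 : ℝ) < x := by exact_mod_cast (show 0 < x by omega)
      have hx2 : (2 : ℝ) ≤ x := by exact_mod_cast (show 2 ≤ x by omega)
      have hx2' : (2 : ℝ) ≤ ((2 * x + 1 : ℕ) : ℝ) := by push_cast; linarith
      have hL1 : 1 < Real.log x := by
        rw [Real.lt_log_iff_exp_lt hx0]
        have := Real.exp_one_lt_d9
        have h3 : (3 : ℝ) ≤ x := by exact_mod_cast hx
        linarith
      have hL : 0 < Real.log x := by linarith
      have hLL : Real.log x ≤ Real.log (2 * x + 1) := Real.log_le_log hx0 (by linarith)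
      have hE1 := hK _ hx2' w hwn
      rw [Nat.floor_natCast] at hE1
      have hE2 := hK x hx2 w hwn
      rw [Nat.floor_natCast] at hE2
      have hcast : (((2 * x + 1 : ℕ) : ℝ)) = 2 * (x : ℝ) + 1 := by push_cast; ring
      rw [hcast] at hE1
      have hK0 : K ≤ max K 0 := le_max_left _ _
      have hM0 : 0 ≤ max K 0 := le_max_right _ _
      have hpow1 : Real.log (2 * x + 1) ^ (y - 2) ≤ Real.log x ^ (y - 2) :=
        Real.rpow_le_rpow_of_nonpos hL hLL (by linarith)
      have hne : ‖e x‖ ≤ 1 := norm_exp_normaliser_le_one hL1.le hy1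
      have hxinvR : ‖(x : ℂ)⁻¹‖ = (x : ℝ)⁻¹ := by simp
      have hwn' : ‖w‖ ≤ 2 := hwn.trans hy2.le
      have h1 : ‖A (2 * x + 1) - G * ((2 * x + 1 : ℕ) : ℂ) * ((Real.log (2 * x + 1) : ℝ) : ℂ) ^ (w - 1)‖ ≤
          max K 0 * (2 * x + 1) * Real.log x ^ (y - 2) := by
        have : ((2 * x + 1 : ℕ) : ℂ) = (((2 * (x : ℝ) + 1 : ℝ)) : ℂ) := by push_cast; ring
        rw [hA, this]
        refine hE1.trans ?_
        have h01 : (0 : ℝ) ≤ 2 * x + 1 := by positivity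
        calc K * (2 * (x : ℝ) + 1) * Real.log (2 * x + 1) ^ (w.re - 2)
            ≤ max K 0 * (2 * x + 1) * Real.log (2 * x + 1) ^ (w.re - 2) := by
              gcongr
              exact Real.rpow_nonneg (by linarith [hLL]) _
          _ ≤ max K 0 * (2 * x + 1) * Real.log x ^ (y - 2) := by
              have hre : w.re = y := by simp [hw]
              rw [hre]
              gcongr
      have h2 : ‖A x - G * (x : ℂ) * ((Real.log x : ℝ) : ℂ) ^ (w - 1)‖ ≤ max K 0 * x * Real.log x ^ (y - 2) := by
        rw [hA]
        refine hE2.trans ?_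
        have hre : w.re = y := by simp [hw]
        rw [hre]
        gcongr
      calc ‖Err x‖ = (x : ℝ)⁻¹ * ‖e x‖ * ‖(A (2 * x + 1) - G * ((2 * x + 1 : ℕ) : ℂ) *
              ((Real.log (2 * x + 1) : ℝ) : ℂ) ^ (w - 1)) - w * (A x - G * (x : ℂ) * ((Real.log x : ℝ) : ℂ) ^ (w - 1))‖ := by
            rw [hErr]; simp only; rw [norm_mul, norm_mul, hxinvR]
        _ ≤ (x : ℝ)⁻¹ * 1 * (max K 0 * (2 * x + 1) * Real.log x ^ (y - 2) + 2 * (max K 0 * x * Real.log x ^ (y - 2))) := by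
            gcongr
            refine (norm_sub_le _ _).trans ?_
            gcongr
            rw [norm_mul]
            gcongr
        _ = max K 0 * Real.log x ^ (y - 2) * ((x : ℝ)⁻¹ * (4 * x + 1)) := by ring
        _ ≤ max K 0 * Real.log x ^ (y - 2) * 5 := by
            have hnn : 0 ≤ max K 0 * Real.log x ^ (y - 2) := mul_nonneg hM0 (Real.rpow_nonneg hL.le _)
            gcongr
            rw [inv_mul_le_iff₀ hx0]
            have h3 : (3 : ℝ) ≤ x := by exact_mod_cast hx
            linarith
        _ = 5 * max K 0 * Real.log x ^ (-(2 - y)) := by rw [show y - 2 = -(2 - y) by ring]; ring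
    have hrhs : Tendsto (fun x : ℕ => 5 * max K 0 * (Real.log x) ^ (-(2 - y))) atTop (𝓝 0) := by
      have h2 : Tendsto (fun x : ℕ => (Real.log x) ^ (-(2 - y))) atTop (𝓝 0) :=
        (tendsto_rpow_neg_atTop (by linarith : 0 < 2 - y)).comp
          (Real.tendsto_log_atTop.comp tendsto_natCast_atTop_atTop)
      simpa using h2.const_mul (5 * max K 0)
    refine squeeze_zero_norm' ?_ hrhs
    filter_upwards [eventually_ge_atTop 3] with x hx
    exact hbound x hx
  have hρ1 : Tendsto ρ atTop (𝓝 1) := by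
    have hform : ∀ x : ℕ, 3 ≤ x → ρ x = Complex.exp ((w - 1) *
        ((Real.log (Real.log (2 * x + 1)) - Real.log (Real.log x) : ℝ) : ℂ)) := by
      intro x hx
      have hx0 : (0 : ℝ) < x := by exact_mod_cast (show 0 < x by omega)
      have hL1pos : 0 < Real.log (2 * (x : ℝ) + 1) := Real.log_pos (by
        have : (1 : ℝ) ≤ x := by exact_mod_cast (show 1 ≤ x by omega)
        linarith)
      rw [hρ, he]
      simp only
      rw [Complex.cpow_def_of_ne_zero (by exact_mod_cast hL1pos.ne'), ← Complex.ofReal_log hL1pos.le,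
        ← Complex.exp_add]
      congr 1
      push_cast
      ring
    have hlim : Tendsto (fun x : ℕ => Complex.exp ((w - 1) *
        ((Real.log (Real.log (2 * x + 1)) - Real.log (Real.log x) : ℝ) : ℂ))) atTop (𝓝 1) := by
      have h0 := tendsto_loglog_twoX_add_one_sub
      have h1 : Tendsto (fun x : ℕ => (w - 1) * ((Real.log (Real.log (2 * x + 1)) - Real.log (Real.log x) : ℝ) : ℂ))
          atTop (𝓝 0) := by
        have := (Complex.continuous_ofReal.tendsto 0).comp h0
        simpa using this.const_mul (w - 1)
      have h2 := (Complex.continuous_exp.tendsto 0).comp h1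
      rw [Complex.exp_zero] at h2
      exact h2
    refine hlim.congr' ?_
    filter_upwards [eventually_ge_atTop 3] with x hx
    exact (hform x hx).symm
  have hmain : Tendsto (fun x : ℕ => (2 - w) * G + (Err x + G * ((2 + (x : ℂ)⁻¹) * ρ x - 2))) atTop
      (𝓝 ((2 - w) * G)) := by
    have hx0 : Tendsto (fun x : ℕ => (x : ℂ)⁻¹) atTop (𝓝 0) := by
      simpa using tendsto_inv_atTop_nhds_zero_nat (𝕜 := ℂ)
    have h2 : Tendsto (fun x : ℕ => (2 + (x : ℂ)⁻¹) * ρ x - 2) atTop (𝓝 0) := by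
      have := ((tendsto_const_nhds (x := (2 : ℂ))).add hx0).mul hρ1
      simpa using this.sub_const 2
    have h3 : Tendsto (fun x : ℕ => Err x + G * ((2 + (x : ℂ)⁻¹) * ρ x - 2)) atTop (𝓝 0) := by
      simpa using hErr0.add (h2.const_mul G)
    simpa using (tendsto_const_nhds (x := (2 - w) * G)).add h3
  have hmain' := hmain.congr' (f₂ := fun x : ℕ => (x : ℂ)⁻¹ * e x *
      ∑ n ∈ Finset.range (x + 1), w ^ (∑ i, cardFactors ((((![C 2 * X + C 1] : Fin 1 → ℤ[X]) i).eval (n : ℤ)).toNat)))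
    (by filter_upwards [eventually_ge_atTop 3] with x hx; exact (hdecomp x hx).symm)
  simpa [hG, he, mul_assoc] using hmain'

/-- The archimedean factor at `f = 2X + 1` is `Γ(y)⁻¹` (`D = natDegree (2X+1) = 1`). [folklore] -/
theorem archFactor_twoX_add_one (y : ℝ) :
    Complex.exp (((y : ℂ) - 1) * (Real.log (∏ i, (((![C 2 * X + C 1] : Fin 1 → ℤ[X]) i).natDegree : ℝ)) : ℂ)) *
      (Complex.Gamma y)⁻¹ ^ 1 = (Complex.Gamma y)⁻¹ := by
  have hd : ((![C 2 * X + C 1] : Fin 1 → ℤ[X]) 0).natDegree = 1 := by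
    simp only [Matrix.cons_val_fin_one]
    exact Polynomial.natDegree_linear (by norm_num)
  rw [Fin.prod_univ_one, hd]
  simp

/-- The crux's real-segment law HOLDS for `(2X + 1)` with `Λ(z) = (2 - z) F(1,z)` (target in the crux's own shape).
[cite: MontgomeryVaughan2007, §7.4 Theorem 7.18 and (7.60)] -/
theorem omegaSegmentLaw_twoX_add_one (y : ℝ) (hy : 5 / 4 < y) (hy' : y < 7 / 4) :
    Tendsto (fun x : ℕ => (x : ℂ)⁻¹ * Complex.exp (((1 : ℕ) : ℂ) * (1 - (y : ℂ)) * (Real.log (Real.log x) : ℂ)) *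
      ∑ n ∈ Finset.range (x + 1), (y : ℂ) ^ (∑ i, cardFactors ((((![C 2 * X + C 1] : Fin 1 → ℤ[X]) i).eval (n : ℤ)).toNat)))
      atTop (𝓝 ((fun z : ℂ => (2 - z) * selbergDelangeOmegaF z) y * (Complex.exp (((y : ℂ) - 1) *
        (Real.log (∏ i, (((![C 2 * X + C 1] : Fin 1 → ℤ[X]) i).natDegree : ℝ)) : ℂ)) * (Complex.Gamma y)⁻¹ ^ 1))) := by
  rw [archFactor_twoX_add_one]
  exact tendsto_normSum_twoX_add_one (y := y) (by linarith) (by linarith)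

/-- **THE CRUX HOLDS AT `f = 2X + 1`** with `Λ(z) = (2 - z) F(1,z)`: holomorphic on `|z| < 2`, `Λ 0 = 2 F(1,0) = 2 =
C(2X+1)` (the pin checked at a value `≠ 1`), and the segment law is `tendsto_normSum_twoX_add_one`. The factor `2 - z`
CANCELS the pole of `F(1,·)` at `2` (odd values have no factor `2`: `E_2 ≡ 1` for this system), so this `Λ` extends
holomorphically to `|z| < 3` and the law survives up to `y < 3`: the wall at `2` of `WallAtTwo*` / `SharpRadius` is the `p = 2`
Euler factor of the SYSTEM `f = X`, not a universal feature — the `∀ f` strengthenings are refuted through `f = X` only.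
[cite: MontgomeryVaughan2007, §7.4 Theorem 7.18 and (7.60)] -/
theorem lsdRealSegment_conclusion_twoX_add_one :
    ∃ Λ : ℂ → ℂ, DifferentiableOn ℂ Λ (Metric.ball 0 2) ∧ Λ 0 = (batemanHornConst (![C 2 * X + C 1] : Fin 1 → ℤ[X]) : ℂ) ∧
      ∀ y : ℝ, 5 / 4 < y → y < 7 / 4 → Filter.Tendsto (fun x : ℕ => (x : ℂ)⁻¹ *
        Complex.exp (((1 : ℕ) : ℂ) * (1 - (y : ℂ)) * (Real.log (Real.log x) : ℂ)) *
        ∑ n ∈ Finset.range (x + 1), (y : ℂ) ^ (∑ i, cardFactors ((((![C 2 * X + C 1] : Fin 1 → ℤ[X]) i).eval (n : ℤ)).toNat)))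
        Filter.atTop (nhds (Λ y * Complex.exp (((y : ℂ) - 1) *
          (Real.log (∏ i, (((![C 2 * X + C 1] : Fin 1 → ℤ[X]) i).natDegree : ℝ)) : ℂ)) * (Complex.Gamma y)⁻¹ ^ 1)) := by
  refine ⟨fun z => (2 - z) * selbergDelangeOmegaF z, ?_, ?_, fun y hy hy' => ?_⟩
  · exact ((differentiableOn_const (2 : ℂ)).sub differentiableOn_id).mul differentiableOn_selbergDelangeOmegaF
  · simp only [sub_zero, selbergDelangeOmegaF_zero, mul_one, batemanHornConst_twoX_add_one]
    norm_num
  · have := omegaSegmentLaw_twoX_add_one y hy hy'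
    simpa [mul_assoc] using this

/-- … which is literally the `k = 1`, `f = 2X + 1` case of the route decl. -/
example (h : Summit.Parity.BatemanHorn.Theses.SelbergDelangeRigidity.LSDRealSegment) :=
  h 1 (![C 2 * X + C 1] : Fin 1 → ℤ[X]) isBatemanHornSystem_twoX_add_one

end

end Summit.Parity.BatemanHorn.Theorems.LSDRealSegment.Negative
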